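import Summits.QuantumFields.YangMills.Theorems.SwapVirialDeficitSigmaTwistedLetterCeilingHaar
import Summits.QuantumFields.YangMills.Theorems.SwapVirialDeficitSigmaTwistedLetterFloor
import HarnessLib

/-!
# The σ-twisted four-leader small ball, CEILING side — IV: `Haar⁴{σ-twisted relations ≤ t} ≤ C·t⁷`

(Overview of the four-file chain `…SigmaTwistedLetterCeiling{Algebra,Shells,Haar,}.lean` and of the reduction — slaved letter, region A by
the three-letter ceiling, region B by the four load-bearing constraints and dyadic shells against slabs — in the header of part I,
`SwapVirialDeficitSigmaTwistedLetterCeilingAlgebra.lean`.)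

This file: §6 region B integrated over the outer letter (Fubini ✓`measurePreserving_piFinSuccAbove` at the outer letter, shells against slabs —
a geometric series, ✓`haar_three_regionB_le`); §7 ★★ `haar_pi_sigmaTwisted_le` (Fubini over the slaved letter FIRST, ✓`Measure.prod_apply_symm`;
region A by ✓`NearlyCommutingThree.haar_pi_nearlyCommuting_three_le`) and ★★ `haar_pi_sigmaTwisted_two_sided` with w2 g54's floor
✓`SigmaTwistedLetterFloor.haar_pi_sigmaTwisted_ge` — the σ-block is `≍ t⁷`, no logarithm.
HONEST LABEL: finite-dimensional Haar-volume bookkeeping toward the fixed-`L` zero-mode factor of the swap-glued femto ring (a prediction row of a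
DRAFT line); nothing about ⟨24197⟩/⟨24194⟩/⟨24497⟩ or any rung is proved; the Yang–Mills mass gap is NOT proved; no summit is proved by a line.
Seat ym-line-sfw-p2 g93 (LEAD of unit sfw-p2, free hands; `--supports stmt-QuantumFields-24197`).  THEOREMS ONLY (0 `def`, 0 `sorry`),
standard axioms.  References: [cite: Vanbaal2001]; [cite: Luscher1983, §2]; [cite: GonzalezarroyoAltes1988]; [folklore].
-/

set_option autoImplicit false

noncomputable section

open MeasureTheory Quaternion Set
open scoped Quaternion ENNReal BigOperators
open Literature.MathematicalPhysics.QuantumLattice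
open Literature.MathematicalPhysics.QuantumFieldTheory (haarProbability)
open Summit.QuantumFields.YangMills.Theorems.SwapTwistDeficit.ToronLog
open Summit.QuantumFields.YangMills.Theorems.ToronValleyVolume.NearlyCommutingCeiling
open Summit.QuantumFields.YangMills.Theorems.SwapVirialDeficit

namespace Summit.QuantumFields.YangMills.Theorems.SwapVirialDeficit.SigmaTwistedCeiling

/-! ## §6 The outer integrals: region B over the outer letter, region A by the three-letter ceiling, and the slaved letter -/

section Assembly

attribute [local instance] Literature.Analysis.FluidPDE.Tao2016.quatMeasurableSpace
  Literature.Analysis.FluidPDE.Tao2016.quatBorelSpace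
  Literature.MathematicalPhysics.QuantumLattice.secondCountableTopology_su2

/-- ★★ **Region B integrated over the outer letter**: for `0 < t ≤ (1/2)^K`, `(1/2)^{K+1} ≤ t`, the product Haar mass of the triples
`(Q₀, Q₂, Q₃)` with `|re q₃| < 1/2` obeying (b), (c), (d), (a) is at most `(262144c³ + 256c²)·t⁴` — the shells `Σ_k 2048c²t⁴·64c·t·2^k` sum
GEOMETRICALLY against the slabs `|re q₃| ≤ 4t·2^k` (no logarithm). [folklore] -/
theorem haar_three_regionB_le {t : ℝ} {K : ℕ} (ht : 0 < t) (hK : (1 / 2 : ℝ) ^ (K + 1) ≤ t) (hK' : t * 2 ^ K ≤ 1) :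
    (Measure.pi fun _ : Fin 3 => haarProbability (Matrix.specialUnitaryGroup (Fin 2) ℂ))
        {R : Fin 3 → Matrix.specialUnitaryGroup (Fin 2) ℂ | |(su2Quat (R 2)).re| < 1 / 2 ∧
          ‖su2Quat (R 2) * su2Quat (R 1) - su2Quat (R 1) * su2Quat (R 2)‖ ≤ t ∧
          |(su2Quat (R 2)).re| * ‖su2Quat (R 2) * su2Quat (R 0) - su2Quat (R 0) * su2Quat (R 2)‖ ≤ 2 * t ∧
          ‖su2Quat (R 0) * (star (su2Quat (R 2)) * su2Quat (R 0) * su2Quat (R 2)) -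
              (star (su2Quat (R 2)) * su2Quat (R 0) * su2Quat (R 2)) * su2Quat (R 0)‖ ≤ 3 * t ∧
          ‖su2Quat (R 0) * su2Quat (R 1) - su2Quat (R 1) * su2Quat (R 0)‖ ≤ t} ≤
      ENNReal.ofReal ((262144 * coneConst ^ 3 + 256 * coneConst ^ 2) * t ^ 4) := by
  set G := Matrix.specialUnitaryGroup (Fin 2) ℂ
  haveI : IsProbabilityMeasure (haarProbability G) :=
    ⟨by simpa [Literature.MathematicalPhysics.QuantumFieldTheory.haarProbability] using Measure.haarMeasure_self (G := G) (K₀ := ⊤)⟩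
  have hc := coneConst_pos
  have hq : Measurable (su2Quat : G → ℍ) :=
    Literature.MathematicalPhysics.QuantumFieldTheory.Balaban1983to89.T4HaarSU2Translate.measurable_su2Quat
  -- the joint event in product form `(Q₃, (Q₀, Q₂))`
  set SB : Set (G × (Fin 2 → G)) := {p | |(su2Quat p.1).re| < 1 / 2 ∧
      (‖su2Quat p.1 * su2Quat (p.2 1) - su2Quat (p.2 1) * su2Quat p.1‖ ≤ t ∧
      |(su2Quat p.1).re| * ‖su2Quat p.1 * su2Quat (p.2 0) - su2Quat (p.2 0) * su2Quat p.1‖ ≤ 2 * t ∧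
      ‖su2Quat (p.2 0) * (star (su2Quat p.1) * su2Quat (p.2 0) * su2Quat p.1) -
          (star (su2Quat p.1) * su2Quat (p.2 0) * su2Quat p.1) * su2Quat (p.2 0)‖ ≤ 3 * t ∧
      ‖su2Quat (p.2 0) * su2Quat (p.2 1) - su2Quat (p.2 1) * su2Quat (p.2 0)‖ ≤ t)} with hSB
  have hq1 : Measurable fun p : G × (Fin 2 → G) => su2Quat p.1 := hq.comp measurable_fst
  have hq20 : Measurable fun p : G × (Fin 2 → G) => su2Quat (p.2 0) := hq.comp ((measurable_pi_apply 0).comp measurable_snd)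
  have hq21 : Measurable fun p : G × (Fin 2 → G) => su2Quat (p.2 1) := hq.comp ((measurable_pi_apply 1).comp measurable_snd)
  have hre : Measurable fun p : G × (Fin 2 → G) => |(su2Quat p.1).re| :=
    ((Quaternion.continuous_re.measurable.comp hq1)).abs
  have hstar : Measurable fun p : G × (Fin 2 → G) => star (su2Quat p.1) := continuous_star.measurable.comp hq1
  have hSBm : MeasurableSet SB := by
    rw [hSB, Set.setOf_and, Set.setOf_and, Set.setOf_and, Set.setOf_and]
    refine (measurableSet_lt hre measurable_const).inter ((measurableSet_le ?_ measurable_const).inter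
      ((measurableSet_le ?_ measurable_const).inter ((measurableSet_le ?_ measurable_const).inter (measurableSet_le ?_ measurable_const))))
    · exact ((hq1.mul hq21).sub (hq21.mul hq1)).norm
    · exact hre.mul ((hq1.mul hq20).sub (hq20.mul hq1)).norm
    · exact ((hq20.mul ((hstar.mul hq20).mul hq1)).sub (((hstar.mul hq20).mul hq1).mul hq20)).norm
    · exact ((hq20.mul hq21).sub (hq21.mul hq20)).norm
  -- the split `R ↦ (R 2, (R 0, R 1))`
  set e := MeasurableEquiv.piFinSuccAbove (fun _ : Fin 3 => G) 2 with he
  have hpre : {R : Fin 3 → G | |(su2Quat (R 2)).re| < 1 / 2 ∧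
      ‖su2Quat (R 2) * su2Quat (R 1) - su2Quat (R 1) * su2Quat (R 2)‖ ≤ t ∧
      |(su2Quat (R 2)).re| * ‖su2Quat (R 2) * su2Quat (R 0) - su2Quat (R 0) * su2Quat (R 2)‖ ≤ 2 * t ∧
      ‖su2Quat (R 0) * (star (su2Quat (R 2)) * su2Quat (R 0) * su2Quat (R 2)) -
          (star (su2Quat (R 2)) * su2Quat (R 0) * su2Quat (R 2)) * su2Quat (R 0)‖ ≤ 3 * t ∧
      ‖su2Quat (R 0) * su2Quat (R 1) - su2Quat (R 1) * su2Quat (R 0)‖ ≤ t} = e ⁻¹' SB := by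
    have s0 : (2 : Fin 3).succAbove 0 = 0 := by decide
    have s1 : (2 : Fin 3).succAbove 1 = 1 := by decide
    ext R
    simp only [Set.mem_setOf_eq, Set.mem_preimage, he, MeasurableEquiv.piFinSuccAbove_apply, Fin.insertNthEquiv,
      Equiv.coe_fn_symm_mk, Fin.removeNth, s0, s1, hSB]
  rw [hpre, (measurePreserving_piFinSuccAbove (fun _ : Fin 3 => haarProbability G) 2).measure_preimage hSBm.nullMeasurableSet,
    Measure.prod_apply hSBm]
  -- the section over the outer letter
  have hsec : ∀ P : G, (Measure.pi fun j : Fin 2 => haarProbability G) (Prod.mk P ⁻¹' SB) ≤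
      (∑ k ∈ Finset.range (K + 1),
          {P' : G | |(su2Quat P').re| ≤ 2 * t * 2 ^ (k + 1)}.indicator (fun _ => ENNReal.ofReal (coneConst ^ 2 * (2048 * t ^ 4))) P) +
        ENNReal.ofReal (coneConst ^ 2 * (256 * t ^ 4)) := by
    intro P
    by_cases hr : |(su2Quat P).re| < 1 / 2
    · have eP : Prod.mk P ⁻¹' SB = {Q : Fin 2 → G |
          ‖su2Quat P * su2Quat (Q 1) - su2Quat (Q 1) * su2Quat P‖ ≤ t ∧
          |(su2Quat P).re| * ‖su2Quat P * su2Quat (Q 0) - su2Quat (Q 0) * su2Quat P‖ ≤ 2 * t ∧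
          ‖su2Quat (Q 0) * (star (su2Quat P) * su2Quat (Q 0) * su2Quat P) -
              (star (su2Quat P) * su2Quat (Q 0) * su2Quat P) * su2Quat (Q 0)‖ ≤ 3 * t ∧
          ‖su2Quat (Q 0) * su2Quat (Q 1) - su2Quat (Q 1) * su2Quat (Q 0)‖ ≤ t} := by
        ext Q; simp only [Set.mem_preimage, hSB, Set.mem_setOf_eq, hr, true_and]
      rw [eP]
      refine (haar_two_constraints_le P hr ht.le hK).trans (le_of_eq ?_)
      congr 1
    · have eP : Prod.mk P ⁻¹' SB = ∅ := by
        ext Q; simp only [Set.mem_preimage, hSB, Set.mem_setOf_eq, hr, false_and, Set.mem_empty_iff_false]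
      rw [eP, measure_empty]; exact bot_le
  refine (lintegral_mono hsec).trans ?_
  -- integrate the step function
  have hSk : ∀ k : ℕ, MeasurableSet {P' : G | |(su2Quat P').re| ≤ 2 * t * 2 ^ (k + 1)} := fun k =>
    measurableSet_le ((Quaternion.continuous_re.measurable.comp hq).abs) measurable_const
  have hmeas : ∀ k : ℕ, Measurable fun P : G =>
      {P' : G | |(su2Quat P').re| ≤ 2 * t * 2 ^ (k + 1)}.indicator (fun _ => ENNReal.ofReal (coneConst ^ 2 * (2048 * t ^ 4))) P :=
    fun k => measurable_const.indicator (hSk k)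
  have hS : Measurable fun P : G => ∑ k ∈ Finset.range (K + 1),
      {P' : G | |(su2Quat P').re| ≤ 2 * t * 2 ^ (k + 1)}.indicator (fun _ => ENNReal.ofReal (coneConst ^ 2 * (2048 * t ^ 4))) P :=
    Finset.measurable_sum _ fun k _ => hmeas k
  rw [lintegral_add_left hS, lintegral_const, measure_univ, mul_one, lintegral_finsetSum _ fun k _ => hmeas k]
  have hterm : ∀ k ∈ Finset.range (K + 1),
      ∫⁻ P, {P' : G | |(su2Quat P').re| ≤ 2 * t * 2 ^ (k + 1)}.indicator (fun _ => ENNReal.ofReal (coneConst ^ 2 * (2048 * t ^ 4))) P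
          ∂haarProbability G ≤ ENNReal.ofReal (131072 * coneConst ^ 3 * t ^ 5 * 2 ^ k) := by
    intro k _
    rw [lintegral_indicator_const (hSk k)]
    calc ENNReal.ofReal (coneConst ^ 2 * (2048 * t ^ 4)) * haarProbability G {P' : G | |(su2Quat P').re| ≤ 2 * t * 2 ^ (k + 1)}
        ≤ ENNReal.ofReal (coneConst ^ 2 * (2048 * t ^ 4)) * ENNReal.ofReal (coneConst * (16 * (2 * t * 2 ^ (k + 1)))) :=
          by gcongr; exact haar_absRe_le _ (by positivity)
      _ = ENNReal.ofReal (131072 * coneConst ^ 3 * t ^ 5 * 2 ^ k) := by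
          rw [← ENNReal.ofReal_mul (by positivity)]
          congr 1; ring
  have hsum := Finset.sum_le_sum hterm
  have hgeom : ∑ k ∈ Finset.range (K + 1), ENNReal.ofReal (131072 * coneConst ^ 3 * t ^ 5 * 2 ^ k) ≤
      ENNReal.ofReal (262144 * coneConst ^ 3 * t ^ 4) := by
    rw [← ENNReal.ofReal_sum_of_nonneg (fun k _ => by positivity)]
    refine ENNReal.ofReal_le_ofReal ?_
    rw [← Finset.mul_sum]
    have hg : ∑ k ∈ Finset.range (K + 1), (2 : ℝ) ^ k ≤ 2 * 2 ^ K := by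
      rw [geom_sum_eq (by norm_num : (2 : ℝ) ≠ 1)]
      norm_num
      rw [pow_succ]
      linarith [pow_pos (by norm_num : (0 : ℝ) < 2) K]
    calc 131072 * coneConst ^ 3 * t ^ 5 * ∑ k ∈ Finset.range (K + 1), (2 : ℝ) ^ k
        ≤ 131072 * coneConst ^ 3 * t ^ 5 * (2 * 2 ^ K) := mul_le_mul_of_nonneg_left hg (by positivity)
      _ = 262144 * coneConst ^ 3 * t ^ 4 * (t * 2 ^ K) := by ring
      _ ≤ 262144 * coneConst ^ 3 * t ^ 4 * 1 := mul_le_mul_of_nonneg_left hK' (by positivity)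
      _ = 262144 * coneConst ^ 3 * t ^ 4 := mul_one _
  calc (∑ k ∈ Finset.range (K + 1),
        ∫⁻ P, {P' : G | |(su2Quat P').re| ≤ 2 * t * 2 ^ (k + 1)}.indicator (fun _ => ENNReal.ofReal (coneConst ^ 2 * (2048 * t ^ 4))) P
          ∂haarProbability G) + ENNReal.ofReal (coneConst ^ 2 * (256 * t ^ 4))
      ≤ ENNReal.ofReal (262144 * coneConst ^ 3 * t ^ 4) + ENNReal.ofReal (coneConst ^ 2 * (256 * t ^ 4)) :=
        add_le_add (hsum.trans hgeom) le_rfl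
    _ = ENNReal.ofReal ((262144 * coneConst ^ 3 + 256 * coneConst ^ 2) * t ^ 4) := by
        rw [← ENNReal.ofReal_add (by positivity) (by positivity)]; congr 1; ring

/-! ## §7 The σ-twisted four-leader ceiling -/

/-- All nine ordered pairs from the three unordered commutator bounds. [folklore] -/
theorem forall_comm_le_of_three {R : Fin 3 → Matrix.specialUnitaryGroup (Fin 2) ℂ} {s : ℝ} (hs : 0 ≤ s)
    (h01 : ‖su2Quat (R 0) * su2Quat (R 1) - su2Quat (R 1) * su2Quat (R 0)‖ ≤ s)
    (h02 : ‖su2Quat (R 0) * su2Quat (R 2) - su2Quat (R 2) * su2Quat (R 0)‖ ≤ s)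
    (h12 : ‖su2Quat (R 1) * su2Quat (R 2) - su2Quat (R 2) * su2Quat (R 1)‖ ≤ s) :
    ∀ μ ν : Fin 3, ‖su2Quat (R μ) * su2Quat (R ν) - su2Quat (R ν) * su2Quat (R μ)‖ ≤ s := by
  have h10 : ‖su2Quat (R 1) * su2Quat (R 0) - su2Quat (R 0) * su2Quat (R 1)‖ ≤ s := by rw [norm_sub_rev]; exact h01
  have h20 : ‖su2Quat (R 2) * su2Quat (R 0) - su2Quat (R 0) * su2Quat (R 2)‖ ≤ s := by rw [norm_sub_rev]; exact h02
  have h21 : ‖su2Quat (R 2) * su2Quat (R 1) - su2Quat (R 1) * su2Quat (R 2)‖ ≤ s := by rw [norm_sub_rev]; exact h12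
  intro μ ν
  fin_cases μ <;> fin_cases ν
  all_goals first | (rw [sub_self, norm_zero]; exact hs) | assumption

/-- The region-B triple event is measurable. [folklore] -/
theorem measurableSet_regionB (t : ℝ) :
    MeasurableSet {R : Fin 3 → Matrix.specialUnitaryGroup (Fin 2) ℂ | |(su2Quat (R 2)).re| < 1 / 2 ∧
      ‖su2Quat (R 2) * su2Quat (R 1) - su2Quat (R 1) * su2Quat (R 2)‖ ≤ t ∧
      |(su2Quat (R 2)).re| * ‖su2Quat (R 2) * su2Quat (R 0) - su2Quat (R 0) * su2Quat (R 2)‖ ≤ 2 * t ∧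
      ‖su2Quat (R 0) * (star (su2Quat (R 2)) * su2Quat (R 0) * su2Quat (R 2)) -
          (star (su2Quat (R 2)) * su2Quat (R 0) * su2Quat (R 2)) * su2Quat (R 0)‖ ≤ 3 * t ∧
      ‖su2Quat (R 0) * su2Quat (R 1) - su2Quat (R 1) * su2Quat (R 0)‖ ≤ t} := by
  have hq : Measurable (su2Quat : Matrix.specialUnitaryGroup (Fin 2) ℂ → ℍ) :=
    Literature.MathematicalPhysics.QuantumFieldTheory.Balaban1983to89.T4HaarSU2Translate.measurable_su2Quat
  have h0 : Measurable fun R : Fin 3 → Matrix.specialUnitaryGroup (Fin 2) ℂ => su2Quat (R 0) := hq.comp (measurable_pi_apply 0)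
  have h1 : Measurable fun R : Fin 3 → Matrix.specialUnitaryGroup (Fin 2) ℂ => su2Quat (R 1) := hq.comp (measurable_pi_apply 1)
  have h2 : Measurable fun R : Fin 3 → Matrix.specialUnitaryGroup (Fin 2) ℂ => su2Quat (R 2) := hq.comp (measurable_pi_apply 2)
  have hre : Measurable fun R : Fin 3 → Matrix.specialUnitaryGroup (Fin 2) ℂ => |(su2Quat (R 2)).re| :=
    (Quaternion.continuous_re.measurable.comp h2).abs
  have hstar : Measurable fun R : Fin 3 → Matrix.specialUnitaryGroup (Fin 2) ℂ => star (su2Quat (R 2)) :=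
    continuous_star.measurable.comp h2
  rw [Set.setOf_and, Set.setOf_and, Set.setOf_and, Set.setOf_and]
  refine (measurableSet_lt hre measurable_const).inter ((measurableSet_le ?_ measurable_const).inter
    ((measurableSet_le ?_ measurable_const).inter ((measurableSet_le ?_ measurable_const).inter (measurableSet_le ?_ measurable_const))))
  · exact ((h2.mul h1).sub (h1.mul h2)).norm
  · exact hre.mul ((h2.mul h0).sub (h0.mul h2)).norm
  · exact ((h0.mul ((hstar.mul h0).mul h2)).sub (((hstar.mul h0).mul h2).mul h0)).norm
  · exact ((h0.mul h1).sub (h1.mul h0)).norm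

/-- ★★ **THE σ-TWISTED FOUR-LEADER CEILING (no logarithm).**  There are `C > 0` and `t₀ > 0` such that for `0 < t ≤ t₀` the
product Haar measure of the quadruples `(C_μ) ∈ SU(2)⁴` satisfying the relations of the swap-glued femto ring up to `t` — `C₀, C₁, C₂`
pairwise commuting up to `t` and the twisted relations `‖q₃q₁ − q₀q₃‖, ‖q₃q₀ − q₁q₃‖, ‖q₃q₂ − q₂q₃‖ ≤ t` for the seam letter `q₃` (the
relations `t a t⁻¹ = b`, `t b t⁻¹ = a`, `t c = c t` of `ℤ³ ⋊_σ ℤ`) — is AT MOST `C·t⁷`.  This is the SAME event as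
✓`SigmaTwistedLetterFloor.haar_pi_sigmaTwisted_ge` (w2 g54, floor `c·t⁷`): the zero-mode block of the swap-glued ring is two-sided
`≍ t⁷` with NO logarithm (swap-central cone of commuting triples ∪ torus stratum ∪ crossing locus all at exponent `7`, the Weyl stratum at `8`),
the stiffness direction of crux ⟨stmt-QuantumFields-24197⟩ `SwapVirialDeficit.SwapGluedStiffness` at the zero-mode level.  Reduction: the first
twisted relation slaves `C₁` to the `t`-ball about `q̄₃q₀q₃` (`32t³`, Fubini over `C₁` first); on `|re q₃| ≥ 1/2` the remaining triple pairwise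
commutes up to `3t` (✓`haar_pi_nearlyCommuting_three_le`, `C₃·81t⁴`); on `|re q₃| < 1/2` the four load-bearing constraints (b) `[q₃,q₂]`,
(c) `re q₃·[q₃,q₀]`, (d) `[q₀, q̄₃q₀q₃]`, (a) `[q₀,q₂]` give `(262144c³ + 256c²)t⁴` by dyadic shells in the transversal part of `q₀`
(✓`haar_three_regionB_le`). [folklore] -/
theorem haar_pi_sigmaTwisted_le :
    ∃ C : ℝ, 0 < C ∧ ∃ t₀ : ℝ, 0 < t₀ ∧ ∀ t : ℝ, 0 < t → t ≤ t₀ →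
      (Measure.pi fun _ : Fin 4 => haarProbability (Matrix.specialUnitaryGroup (Fin 2) ℂ)).real
          {C : Fin 4 → (Matrix.specialUnitaryGroup (Fin 2) ℂ) |
            (∀ μ ν : Fin 3, ‖su2Quat (C μ.castSucc) * su2Quat (C ν.castSucc) - su2Quat (C ν.castSucc) * su2Quat (C μ.castSucc)‖ ≤ t) ∧
            ∀ μ : Fin 3, ‖su2Quat (C (Fin.last 3)) * su2Quat (C (Equiv.swap (0 : Fin 3) 1 μ).castSucc) -
              su2Quat (C μ.castSucc) * su2Quat (C (Fin.last 3))‖ ≤ t} ≤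
        C * t ^ 7 := by
  set G := Matrix.specialUnitaryGroup (Fin 2) ℂ
  obtain ⟨C₃, hC₃, t₃, ht₃, h3⟩ := NearlyCommutingThree.haar_pi_nearlyCommuting_three_le
  have hc := coneConst_pos
  refine ⟨32 * (81 * C₃ + (262144 * coneConst ^ 3 + 256 * coneConst ^ 2)), by positivity, min (t₃ / 3) (1 / 2),
    lt_min (by positivity) (by norm_num), fun t ht ht₀ => ?_⟩
  have ht3 : 3 * t ≤ t₃ := by have := ht₀.trans (min_le_left _ _); linarith
  have ht1 : t ≤ 1 := by have := ht₀.trans (min_le_right _ _); linarith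
  haveI : IsProbabilityMeasure (haarProbability G) :=
    ⟨by simpa [Literature.MathematicalPhysics.QuantumFieldTheory.haarProbability] using Measure.haarMeasure_self (G := G) (K₀ := ⊤)⟩
  have hq : Measurable (su2Quat : G → ℍ) :=
    Literature.MathematicalPhysics.QuantumFieldTheory.Balaban1983to89.T4HaarSU2Translate.measurable_su2Quat
  -- the number of shells: `2^K ≤ t⁻¹ < 2^{K+1}`
  have hX1 : (1 : ℝ) ≤ t⁻¹ := (one_le_inv₀ ht).2 ht1
  obtain ⟨K, hK1, hK2⟩ := exists_nat_pow_near hX1 (by norm_num : (1 : ℝ) < 2)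
  have hK : (1 / 2 : ℝ) ^ (K + 1) ≤ t := by
    rw [one_div, inv_pow]
    exact ((inv_lt_comm₀ (by positivity) ht).2 hK2).le
  have hK' : t * 2 ^ K ≤ 1 := by
    have h := mul_le_mul_of_nonneg_left hK1 ht.le
    rwa [mul_inv_cancel₀ ht.ne'] at h
  -- the triple events and the joint event with the slaved letter
  set OA : Set (Fin 3 → G) := {R | ∀ μ ν : Fin 3, ‖su2Quat (R μ) * su2Quat (R ν) - su2Quat (R ν) * su2Quat (R μ)‖ ≤ 3 * t} with hOA
  set OB : Set (Fin 3 → G) := {R | |(su2Quat (R 2)).re| < 1 / 2 ∧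
      ‖su2Quat (R 2) * su2Quat (R 1) - su2Quat (R 1) * su2Quat (R 2)‖ ≤ t ∧
      |(su2Quat (R 2)).re| * ‖su2Quat (R 2) * su2Quat (R 0) - su2Quat (R 0) * su2Quat (R 2)‖ ≤ 2 * t ∧
      ‖su2Quat (R 0) * (star (su2Quat (R 2)) * su2Quat (R 0) * su2Quat (R 2)) -
          (star (su2Quat (R 2)) * su2Quat (R 0) * su2Quat (R 2)) * su2Quat (R 0)‖ ≤ 3 * t ∧
      ‖su2Quat (R 0) * su2Quat (R 1) - su2Quat (R 1) * su2Quat (R 0)‖ ≤ t} with hOB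
  have hOAm : MeasurableSet OA := NearlyCommutingThree.measurableSet_nearlyCommuting_three (3 * t)
  have hOBm : MeasurableSet OB := measurableSet_regionB t
  set O := OA ∪ OB with hO
  have hOm : MeasurableSet O := hOAm.union hOBm
  set E : Set (G × (Fin 3 → G)) :=
    {p | p.2 ∈ O ∧ ‖su2Quat p.1 - star (su2Quat (p.2 2)) * su2Quat (p.2 0) * su2Quat (p.2 2)‖ ≤ t} with hE
  have hEm : MeasurableSet E := by
    rw [hE, Set.setOf_and]
    refine (measurable_snd hOm).inter (measurableSet_le ?_ measurable_const)
    have h1 : Measurable fun p : G × (Fin 3 → G) => su2Quat p.1 := hq.comp measurable_fst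
    have h20 : Measurable fun p : G × (Fin 3 → G) => su2Quat (p.2 0) := hq.comp ((measurable_pi_apply 0).comp measurable_snd)
    have h22 : Measurable fun p : G × (Fin 3 → G) => su2Quat (p.2 2) := hq.comp ((measurable_pi_apply 2).comp measurable_snd)
    exact (h1.sub (((continuous_star.measurable.comp h22).mul h20).mul h22)).norm
  -- ★ the pointwise reduction
  set e₁ := MeasurableEquiv.piFinSuccAbove (fun _ : Fin 4 => G) 1 with he₁
  have hincl : {C : Fin 4 → G |
      (∀ μ ν : Fin 3, ‖su2Quat (C μ.castSucc) * su2Quat (C ν.castSucc) - su2Quat (C ν.castSucc) * su2Quat (C μ.castSucc)‖ ≤ t) ∧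
      ∀ μ : Fin 3, ‖su2Quat (C (Fin.last 3)) * su2Quat (C (Equiv.swap (0 : Fin 3) 1 μ).castSucc) -
        su2Quat (C μ.castSucc) * su2Quat (C (Fin.last 3))‖ ≤ t} ⊆ e₁ ⁻¹' E := by
    intro C hC
    obtain ⟨hcomm, htw⟩ := hC
    -- name the letters
    have c0 : ((0 : Fin 3).castSucc : Fin 4) = 0 := by decide
    have c1 : ((1 : Fin 3).castSucc : Fin 4) = 1 := by decide
    have c2 : ((2 : Fin 3).castSucc : Fin 4) = 2 := by decide
    have c3 : (Fin.last 3 : Fin 4) = 3 := by decide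
    have sw0 : (Equiv.swap (0 : Fin 3) 1) 0 = 1 := by decide
    have sw1 : (Equiv.swap (0 : Fin 3) 1) 1 = 0 := by decide
    have sw2 : (Equiv.swap (0 : Fin 3) 1) 2 = 2 := by decide
    have h01 := hcomm 0 1; rw [c0, c1] at h01
    have h02 := hcomm 0 2; rw [c0, c2] at h02
    have hT0 := htw 0; rw [sw0, c1, c0, c3] at hT0
    have hT1 := htw 1; rw [sw1, c0, c1, c3] at hT1
    have hT2 := htw 2; rw [sw2, c2, c3] at hT2
    set q₀ := su2Quat (C 0)
    set q₁ := su2Quat (C 1)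
    set q₂ := su2Quat (C 2)
    set q₃ := su2Quat (C 3)
    have n₀ : ‖q₀‖ = 1 := norm_su2Quat _
    have n₃ : ‖q₃‖ = 1 := norm_su2Quat _
    -- the image of `C` under the split
    have he : e₁ C = (C 1, ![C 0, C 2, C 3]) := by
      rw [he₁, MeasurableEquiv.piFinSuccAbove_apply]
      refine Prod.ext rfl (funext fun j => ?_)
      fin_cases j <;> rfl
    rw [Set.mem_preimage, he, hE]
    simp only [Set.mem_setOf_eq, Matrix.cons_val_zero, Matrix.cons_val]
    refine ⟨?_, by rw [norm_sub_conj_eq n₃]; exact hT0⟩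
    by_cases hr : 1 / 2 ≤ |q₃.re|
    · -- region A: the triple `(C 0, C 2, C 3)` pairwise commutes up to `3t`
      left
      rw [hOA]
      refine forall_comm_le_of_three (by positivity) ?_ ?_ ?_
      · show ‖q₀ * q₂ - q₂ * q₀‖ ≤ 3 * t
        linarith [norm_nonneg (q₀ * q₂ - q₂ * q₀)]
      · show ‖q₀ * q₃ - q₃ * q₀‖ ≤ 3 * t
        rw [norm_sub_rev]; exact norm_comm_le_three_mul n₃ hr hT0 hT1
      · show ‖q₂ * q₃ - q₃ * q₂‖ ≤ 3 * t
        rw [norm_sub_rev]; linarith [norm_nonneg (q₃ * q₂ - q₂ * q₃)]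
    · -- region B
      right
      rw [hOB]
      refine ⟨not_le.1 hr, hT2, abs_re_mul_norm_comm_le n₃ hT0 hT1, norm_comm_conj_le n₀.le n₃ h01 hT0, h02⟩
  -- ★ Fubini over the slaved letter
  have hfib : ∀ R : Fin 3 → G, haarProbability G ((fun P : G => (P, R)) ⁻¹' E) ≤ O.indicator (fun _ => ENNReal.ofReal (32 * t ^ 3)) R := by
    intro R
    by_cases hR : R ∈ O
    · rw [Set.indicator_of_mem hR]
      set w := star (su2Quat (R 2)) * su2Quat (R 0) * su2Quat (R 2) with hw
      have hw1 : ‖w‖ = 1 := by rw [hw, norm_mul, norm_mul, norm_star, norm_su2Quat, norm_su2Quat, mul_one, mul_one]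
      have hw0 : w ≠ 0 := by intro h; rw [h, norm_zero] at hw1; exact zero_ne_one hw1
      have hwq : su2Quat (quatToSU2 w) = w := by
        rw [Literature.MathematicalPhysics.QuantumFieldTheory.Balaban1983to89.T4HaarSU2Translate.su2Quat_quatToSU2 hw0, hw1, inv_one, one_smul]
      have eP : (fun P : G => (P, R)) ⁻¹' E = {P : G | ‖su2Quat P - su2Quat (quatToSU2 w)‖ ≤ t} := by
        ext P; simp only [Set.mem_preimage, hE, Set.mem_setOf_eq, hR, true_and, hwq, ← hw]
      rw [eP]
      exact haar_ball_le _ ht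
    · rw [Set.indicator_of_notMem hR]
      have eP : (fun P : G => (P, R)) ⁻¹' E = ∅ := by
        ext P; simp only [Set.mem_preimage, hE, Set.mem_setOf_eq, hR, false_and, Set.mem_empty_iff_false]
      rw [eP, measure_empty]
  -- ★ the two triple events
  have hA : (Measure.pi fun _ : Fin 3 => haarProbability G) OA ≤ ENNReal.ofReal (81 * C₃ * t ^ 4) := by
    have h := h3 (3 * t) (by positivity) (ht3.trans le_rfl)
    rw [← hOA] at h
    have hfin : (Measure.pi fun _ : Fin 3 => haarProbability G) OA ≠ ∞ := measure_ne_top _ _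
    rw [← ENNReal.ofReal_toReal hfin]
    refine ENNReal.ofReal_le_ofReal ?_
    calc ((Measure.pi fun _ : Fin 3 => haarProbability G) OA).toReal ≤ C₃ * (3 * t) ^ 4 := h
      _ = 81 * C₃ * t ^ 4 := by ring
  have hB := haar_three_regionB_le (K := K) ht hK hK'
  rw [← hOB] at hB
  -- assemble
  have hmain : (Measure.pi fun _ : Fin 4 => haarProbability G)
      {C : Fin 4 → G |
        (∀ μ ν : Fin 3, ‖su2Quat (C μ.castSucc) * su2Quat (C ν.castSucc) - su2Quat (C ν.castSucc) * su2Quat (C μ.castSucc)‖ ≤ t) ∧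
        ∀ μ : Fin 3, ‖su2Quat (C (Fin.last 3)) * su2Quat (C (Equiv.swap (0 : Fin 3) 1 μ).castSucc) -
          su2Quat (C μ.castSucc) * su2Quat (C (Fin.last 3))‖ ≤ t} ≤
      ENNReal.ofReal (32 * t ^ 3) * (ENNReal.ofReal (81 * C₃ * t ^ 4) + ENNReal.ofReal ((262144 * coneConst ^ 3 + 256 * coneConst ^ 2) * t ^ 4)) := by
    calc (Measure.pi fun _ : Fin 4 => haarProbability G) _
        ≤ (Measure.pi fun _ : Fin 4 => haarProbability G) (e₁ ⁻¹' E) := measure_mono hincl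
      _ = ((haarProbability G).prod (Measure.pi fun j : Fin 3 => haarProbability G)) E :=
          (measurePreserving_piFinSuccAbove (fun _ : Fin 4 => haarProbability G) 1).measure_preimage hEm.nullMeasurableSet
      _ = ∫⁻ R, haarProbability G ((fun P : G => (P, R)) ⁻¹' E) ∂(Measure.pi fun j : Fin 3 => haarProbability G) :=
          Measure.prod_apply_symm hEm
      _ ≤ ∫⁻ R, O.indicator (fun _ => ENNReal.ofReal (32 * t ^ 3)) R ∂(Measure.pi fun j : Fin 3 => haarProbability G) :=
          lintegral_mono hfib
      _ = ENNReal.ofReal (32 * t ^ 3) * (Measure.pi fun j : Fin 3 => haarProbability G) O := lintegral_indicator_const hOm _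
      _ ≤ ENNReal.ofReal (32 * t ^ 3) * ((Measure.pi fun j : Fin 3 => haarProbability G) OA +
            (Measure.pi fun j : Fin 3 => haarProbability G) OB) := by
          gcongr; exact measure_union_le _ _
      _ ≤ ENNReal.ofReal (32 * t ^ 3) * (ENNReal.ofReal (81 * C₃ * t ^ 4) +
            ENNReal.ofReal ((262144 * coneConst ^ 3 + 256 * coneConst ^ 2) * t ^ 4)) := by
          gcongr
  -- pass to real numbers
  have hX : ENNReal.ofReal (32 * t ^ 3) * (ENNReal.ofReal (81 * C₃ * t ^ 4) + ENNReal.ofReal ((262144 * coneConst ^ 3 + 256 * coneConst ^ 2) * t ^ 4)) =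
      ENNReal.ofReal (32 * (81 * C₃ + (262144 * coneConst ^ 3 + 256 * coneConst ^ 2)) * t ^ 7) := by
    rw [← ENNReal.ofReal_add (by positivity) (by positivity), ← ENNReal.ofReal_mul (by positivity)]
    congr 1; ring
  rw [hX] at hmain
  exact ENNReal.toReal_le_of_le_ofReal (by positivity) hmain

/-- ★★ **Two-sided small-ball law of the σ-twisted zero-mode block** (with ✓`SigmaTwistedLetterFloor.haar_pi_sigmaTwisted_ge` of seat w2 g54):
`c·t⁷ ≤ Haar⁴{σ-twisted relations ≤ t} ≤ C·t⁷` for `0 < t ≤ t₀` — exponent `7`, no logarithm. [folklore] -/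
theorem haar_pi_sigmaTwisted_two_sided :
    ∃ c : ℝ, 0 < c ∧ ∃ C : ℝ, 0 < C ∧ ∃ t₀ : ℝ, 0 < t₀ ∧ ∀ t : ℝ, 0 < t → t ≤ t₀ →
      c * t ^ 7 ≤ (Measure.pi fun _ : Fin 4 => haarProbability (Matrix.specialUnitaryGroup (Fin 2) ℂ)).real
          {C : Fin 4 → (Matrix.specialUnitaryGroup (Fin 2) ℂ) |
            (∀ μ ν : Fin 3, ‖su2Quat (C μ.castSucc) * su2Quat (C ν.castSucc) - su2Quat (C ν.castSucc) * su2Quat (C μ.castSucc)‖ ≤ t) ∧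
            ∀ μ : Fin 3, ‖su2Quat (C (Fin.last 3)) * su2Quat (C (Equiv.swap (0 : Fin 3) 1 μ).castSucc) -
              su2Quat (C μ.castSucc) * su2Quat (C (Fin.last 3))‖ ≤ t} ∧
      (Measure.pi fun _ : Fin 4 => haarProbability (Matrix.specialUnitaryGroup (Fin 2) ℂ)).real
          {C : Fin 4 → (Matrix.specialUnitaryGroup (Fin 2) ℂ) |
            (∀ μ ν : Fin 3, ‖su2Quat (C μ.castSucc) * su2Quat (C ν.castSucc) - su2Quat (C ν.castSucc) * su2Quat (C μ.castSucc)‖ ≤ t) ∧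
            ∀ μ : Fin 3, ‖su2Quat (C (Fin.last 3)) * su2Quat (C (Equiv.swap (0 : Fin 3) 1 μ).castSucc) -
              su2Quat (C μ.castSucc) * su2Quat (C (Fin.last 3))‖ ≤ t} ≤ C * t ^ 7 := by
  obtain ⟨c, hc, t₁, ht₁, hlow⟩ := SigmaTwistedLetterFloor.haar_pi_sigmaTwisted_ge
  obtain ⟨C, hC, t₂, ht₂, hup⟩ := haar_pi_sigmaTwisted_le
  exact ⟨c, hc, C, hC, min t₁ t₂, lt_min ht₁ ht₂, fun t ht htle =>
    ⟨hlow t ht (htle.trans (min_le_left _ _)), hup t ht (htle.trans (min_le_right _ _))⟩⟩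

end Assembly

end Summit.QuantumFields.YangMills.Theorems.SwapVirialDeficit.SigmaTwistedCeiling

end
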